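import Literature.Geometry.Riemannian.RiemannianDistance
import Literature.Geometry.Lorentzian.LeviCivita
import Literature.Geometry.Lorentzian.EnergyCurrents
import Literature.Geometry.Lorentzian.Volume
import HarnessLib

/-!
# Splitting at infinity of a complete 4-dimensional gradient shrinking Ricci soliton along a
# collapsed (non-decaying scalar curvature) direction (named fact, smooth export)

The named fact `shrinkerSplittingAtInfinity_four` (no `_holds`: Hamilton–Cheeger–Gromov
compactness of Ricci flows, Perelman's reduced volume based at the singular time and
pseudolocality are not in the tree) packages, in the smooth vocabulary of the tree
(`PseudoRiemannianMetric` with `[g.HasLeviCivita]`, `g.ricci`, `g.hessian`, `g.scalarCurvature`,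
`g.gradSq`, `g.edist`, `mfderiv` on the product manifold `N × ℝ`), the following PRINTED chain,
for a complete connected 4-dimensional gradient shrinking Ricci soliton `(M, g, f)`,
`Ric + Hess f = g/2`, normalised by `R + |∇f|² = f`, whose scalar curvature is BOUNDED, `R ≤ C`,
and does NOT decay at infinity (`∃ ε > 0`: every compact set misses a point with `R ≥ ε`).

1. [MunteanuWang2015, Thm. 1, p. 2] "Let `(M, g, f)` be a four dimensional shrinking gradient
   Ricci soliton with bounded scalar curvature `S`. Then there exists a constant `c > 0` so that
   `|Rm| ≤ c S` on `M`." (p. 2: "Recall that a complete manifold `(M,g)` is a gradient Ricci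
   soliton if …".) Hence `|Rm_g| ≤ cC`, and the Ricci flow associated with the soliton,
   `g(t) = (1-t) ψ_t^* g`, `∂_t ψ_t = ∇f/(1-t)`, `ψ_0 = id`, `t ∈ [0,1)` ([BertellottiBuzano2025,
   §2, p. 7]; [Naber2010, Lemma 1.1]) is a complete Type I Ricci flow:
   `|Rm_{g(t)}|(x) = |Rm_g|(ψ_t x)/(1-t) ≤ cC/(1-t)` ([BertellottiBuzano2025, (2.8), p. 7]).
2. [EndersMullerTopping2010, Def. 1.2, p. 3] "A space-time sequence `(p_i,t_i)` with `p_i ∈ M`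
   and `t_i ↗ T` in a Ricci flow is called an essential blow-up sequence if there exists a
   constant `c > 0` such that `|Rm_{g(t_i)}|_{g(t_i)}(p_i) ≥ c/(T-t_i)`. A point `p ∈ M` in a
   Type I Ricci flow is called a (general) Type I singular point if there exists an essential
   blow-up sequence with `p_i → p` on `M`. We denote the set of all Type I singular points by
   `Σ_I`." THIS is what makes an ARBITRARY non-decaying escaping sequence `x_k` (`R(x_k) ≥ ε`)
   enough: write `x_k = ψ_{t_k}(q_k)` with `q_k` on the compact level set `{f = c₀}`, `c₀ > C`
   (`f` is proper and increases to `∞` along `ψ_t`, [HaslhoferMuller2011, Lemma 2.1]); then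
   `t_k → 1` and `|Rm_{g(t_k)}|(q_k) = |Rm_g|(x_k)/(1-t_k) ≥ (ε/c₄)/(1-t_k)`, an essential blow-up
   sequence, so every limit point `q*` of `(q_k)` is a Type I singular point.
3. [EndersMullerTopping2010, Thm. 1.4, p. 3] "Let `(Mⁿ,g(t))` be a Type I Ricci flow on `[0,T)`
   and suppose `p ∈ Σ_I` is a Type I singular point as in Definition 1.2. Then for every sequence
   `λ_j → ∞`, the rescaled Ricci flows `(M, g_j(t), p)` defined on `[-λ_j T, 0)` by
   `g_j(t) := λ_j g(T + t/λ_j)` subconverge to a normalized nontrivial gradient shrinking soliton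
   in canonical form." (Flows of "smooth complete Riemannian `n`-manifolds", p. 3; canonical form
   (2.2) and normalisation (2.1) `R_g + |∇f|²_g - f = 0`, p. 5; the limit is complete, Thm. 2.6.)
   At `t = -1`: `(M, g_j(-1), q*) = (M, ψ_{1-1/λ_j}^* g, q*) ≅ (M, g, ψ_{1-1/λ_j}(q*))` — the
   pointed sequence ALONG THE INTEGRAL CURVE of `∇f` through the fixed point `q*` — subconverges
   in the pointed smooth Cheeger–Gromov sense to a complete NON-FLAT normalised 4-d shrinker
   `(X, g_X, f_X)` ([MunteanuWang2019, proof of Thm. 5.1, p. 21]; [BertellottiBuzano2025, Thm. 1.8,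
   pp. 5–6]: "`(M,g,x_k) → (X,g_X,x_∞)` in the pointed smooth Cheeger–Gromov sense, where `X` is
   a smooth four-dimensional Ricci shrinker splitting isometrically as `(N × ℝ, g_N + dt²)`, with
   `N` a smooth three-dimensional Ricci shrinker … Finally, `X` is isometric to flat `ℝ⁴` if and
   only if `S(x_k) → 0`").
4. [Naber2010, Lemma 4.1, §4] "Let `f : M → ℝ` be a smooth function with `|∇²f| ≤ C` and
   `|∇f|(x) → ∞` as `x → ∞`. Then `∀` sequence `x_n → ∞` such that
   `(M,g,x_n) → (M_∞,g_∞,x_∞)` [`C^{1,α}`-Cheeger–Gromov] we have that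
   `(M_∞,g_∞) ≈ (ℝ, ds²) × (N, h)` splits isometrically." Here `∇²f = g/2 - Ric` is bounded and
   `|∇f|² = f - R ≥ f - C → ∞`; so `X = N × ℝ`.
5. [HaslhoferMuller2011, §2, p. 5] "the potential has the form `f(x,y) = f̃(x) + ¼|y-y₀|²` after
   splitting `M ≅ M̃ × ℝᵏ` isometrically" (also [Naber2010, proof of Lemma 2.1];
   [BertellottiBuzano2025, p. 26]). Restricting `Ric_X + Hess f_X = g_X/2`, `R_X + |∇f_X|² = f_X`
   to `N`: `Ric_h + Hess φ = h/2`, `R_h + |∇φ|² = φ` with `f_X = φ(y) + (t-t₀)²/4`; `N` is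
   complete and connected (a factor of `X`), non-flat (`Rm_X = Rm_h ⊕ 0`), hence `R_h ≢ 0`.

EXPORTED CONCLUSION: a faithful WEAKENING of "pointed smooth Cheeger–Gromov convergence of
`(M, g, x_k)` to `(N × ℝ, h + dt²)`", keeping `C¹`-closeness of the metrics and `C⁰`-closeness of
the scalar curvatures on the pieces `{φ < R} × (-R, R)` (bounded subsets of `N × ℝ` by
[HaslhoferMuller2011, Lemma 2.1] on `N`): transplant maps `Φ` (with inverse `Ψ` on the open
image), `(1±η)`-isometric via `mfderiv`, with `|R_g ∘ Φ - R_h ∘ pr₁| ≤ η`. First user: stub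
`stub_collapsedDirectionReduction` of crux `EntropyRung.NoncompactShrinkerGap`
(Summits/SmoothPoincare4), where the 3-d factor feeds the upper semicontinuity of the Gaussian
density. Nothing about entropies or integrals is asserted here.

## What is NOT here

Pointed Cheeger–Gromov–Hamilton convergence as a notion, Type I flows, `Σ_I`, the reduced volume
based at the singular time, pseudolocality, the associated flow `ψ_t` of a soliton — i.e. what is
needed to PROVE the fact; the classification of 3-d shrinkers (not needed by the user); the
general `n`-dimensional statements.

## References

* [MunteanuWang2015] O. Munteanu, J. Wang, *Geometry of shrinking Ricci solitons*, Compositio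
  Math. 151 (2015), 2273–2300 = arXiv:1410.3813: Thm. 1 (p. 2), Thm. 2.5 (p. 9). READ.
* [EndersMullerTopping2010] J. Enders, R. Müller, P. M. Topping, *On Type-I singularities in
  Ricci flow*, Comm. Anal. Geom. 19 (2011), 905–922 = arXiv:1005.1624: Def. 1.2, Thm. 1.4 (p. 3),
  Thm. 2.6, proof of Thm. 1.4 (pp. 6–7). READ.
* [Naber2010] A. Naber, *Noncompact shrinking four solitons with nonnegative curvature*, J. reine
  angew. Math. 645 (2010), 125–153 = arXiv:0710.5579: Def. 1.2, Lemma 1.1, Thms. 1.3–1.4,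
  Lemma 2.1, Lemma 4.1, Props. 4.1–4.2, Cor. 4.1. READ.
* [BertellottiBuzano2025] A. Bertellotti, R. Buzano, *Geometric structure of ends of Ricci
  shrinkers*, arXiv:2508.10790: Thms. 1.7–1.8 (pp. 5–6), §2 (p. 7), §6.2 (pp. 26–27). READ.
* [MunteanuWang2019] O. Munteanu, J. Wang, *Structure at infinity for shrinking Ricci
  solitons*, Ann. Sci. ÉNS 52 (2019) = arXiv:1606.01861: Thm. 1.5 and the remark after it
  (p. 4: the per-end dichotomy "`S → 0` or `inf S > 0`" is OPEN), Thm. 5.1 and proof (p. 21).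
* [HaslhoferMuller2011] R. Haslhofer, R. Müller, GAFA 21 (2011) = arXiv:1005.3255: §2, Lemma 2.1.
-/

noncomputable section

open scoped Manifold ContDiff Topology ENNReal NNReal
open Set

namespace Literature.Geometry.Riemannian

open Lorentzian

/-- **Splitting at infinity of a complete 4-d gradient shrinker with bounded, non-decaying scalar
curvature, exported in smooth vocabulary** (Munteanu–Wang 2015 Thm. 1 + Enders–Müller–Topping
2011 Def. 1.2/Thm. 1.4 + Naber 2010 Lemma 4.1 + Bertellotti–Buzano 2025 Thm. 1.8; the chain and
the verbatim statements are in the module docstring). DATA: `M` a connected non-compact smooth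
4-manifold, `g` a complete Riemannian metric (closed `g`-balls compact) with its Levi-Civita
connection, `f` smooth, `Ric + Hess f = g/2`, `R + |∇f|² = f`, `R ≢ 0`, `R ≤ C`, and
`∃ ε > 0 ∀ K compact ∃ x ∉ K, ε ≤ R(x)`. CONCLUSION: there are a connected smooth 3-manifold `N`
(Hausdorff, second countable), a complete Riemannian `h` with Levi-Civita connection and a smooth
`φ` with `Ric_h + Hess φ = h/2`, `R_h + |∇φ|² = φ`, `R_h ≢ 0` — the 3-d factor of the non-flat
normalised limit shrinker `X = N × ℝ`, `f_X = φ + (t-t₀)²/4`, of the blow-ups at a Type I singular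
point `q* ∈ Σ_I` (EMT Def. 1.2 via the essential blow-up sequence `(q_k, t_k)`,
`x_k = ψ_{t_k}(q_k)`; EMT Thm. 1.4; Naber Lemma 4.1; HM §2) — and, for every `R` and `η > 0`
(pointed smooth Cheeger–Gromov convergence of `(M, g, ψ_{1-1/λ_j}(q*))` to `(N × ℝ, h + dt²)`,
weakened to `C¹`/`C⁰` closeness on the bounded pieces `{φ < R} × (-R, R)`): an open
`U ⊇ {φ < R} × (-R, R)` in `N × ℝ`, `Φ : N × ℝ → M` smooth on `U` with open image,
`Ψ : M → N × ℝ` smooth on `Φ(U)` with `Ψ ∘ Φ = id` on `U`, such that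
`(1-η)(h(v,v) + s²) ≤ g(dΦ(v,s), dΦ(v,s)) ≤ (1+η)(h(v,v) + s²)` and `|R_g(Φ p) - R_h(p.1)| ≤ η` on
`U`. Special case (dimension 4, one shrinker) of the cited theorems.
-- TODO(general form): EMT 2011 Thm 1.4 (complete Type I flows, all `n`) and Naber 2010 Prop 4.1
-- need Hamilton–Cheeger–Gromov compactness of flows and the reduced volume at the singular time.
[cite: EndersMullerTopping2010, Def. 1.2 and Thm. 1.4 (p. 3)] [cite: MunteanuWang2015, Thm. 1 (p. 2)]
[cite: Naber2010, Lemma 4.1 and Prop. 4.1 (§4)] [cite: BertellottiBuzano2025, Thm. 1.8 (pp. 5–6), p. 26]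
-/
def shrinkerSplittingAtInfinity_four : Prop :=
  ∀ (M : Type) [TopologicalSpace M] [T2Space M] [SecondCountableTopology M]
    [ChartedSpace (EuclideanSpace ℝ (Fin 4)) M] [IsManifold (𝓡 4) ∞ M] [ConnectedSpace M]
    [NoncompactSpace M] [T3Space M] [MeasurableSpace M] [BorelSpace M]
    (g : PseudoRiemannianMetric (𝓡 4) ∞ (EuclideanSpace ℝ (Fin 4)) (TangentSpace (𝓡 4) : M → Type _))
    [g.HasLeviCivita] (f : M → ℝ) (hg : g.IsRiemannian),
    (∀ (x : M) (r : NNReal), IsCompact {y : M | g.edist hg x y ≤ r}) →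
    ContMDiff (𝓡 4) 𝓘(ℝ, ℝ) ∞ f →
    (∀ (x : M) (X Y : TangentSpace (𝓡 4) x),
      g.ricci x X Y + g.hessian f x X Y = (1 / 2 : ℝ) * g.val x X Y) →
    (∀ x : M, g.scalarCurvature x + g.gradSq f x = f x) →
    (∃ x : M, g.scalarCurvature x ≠ 0) →
    (∃ C : ℝ, ∀ x : M, g.scalarCurvature x ≤ C) →
    (∃ ε : ℝ, 0 < ε ∧ ∀ K : Set M, IsCompact K → ∃ x, x ∉ K ∧ ε ≤ g.scalarCurvature x) →
    ∃ (N : Type) (_ : TopologicalSpace N) (_ : T2Space N) (_ : SecondCountableTopology N)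
      (_ : ChartedSpace (EuclideanSpace ℝ (Fin 3)) N) (_ : IsManifold (𝓡 3) ∞ N)
      (_ : ConnectedSpace N) (_ : T3Space N) (_ : MeasurableSpace N) (_ : BorelSpace N)
      (h : PseudoRiemannianMetric (𝓡 3) ∞ (EuclideanSpace ℝ (Fin 3)) (TangentSpace (𝓡 3) : N → Type _))
      (_ : h.HasLeviCivita) (φ : N → ℝ) (hh : h.IsRiemannian),
      -- (N1) `(N, h, φ)` is a complete normalised 3-d gradient shrinker, non-flat
      (∀ (y : N) (r : NNReal), IsCompact {z : N | h.edist hh y z ≤ r}) ∧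
      ContMDiff (𝓡 3) 𝓘(ℝ, ℝ) ∞ φ ∧
      (∀ (y : N) (X Y : TangentSpace (𝓡 3) y),
        h.ricci y X Y + h.hessian φ y X Y = (1 / 2 : ℝ) * h.val y X Y) ∧
      (∀ y : N, h.scalarCurvature y + h.gradSq φ y = φ y) ∧
      (∃ y : N, h.scalarCurvature y ≠ 0) ∧
      -- (N2) transplants: `(M, g)` contains, for every `R` and `η > 0`, a `(1±η)`-quasi-isometric
      -- diffeomorphic copy of the piece `{φ < R} × (-R, R)` of `(N × ℝ, h + dt²)` on which the
      -- scalar curvatures are `η`-close; `N × ℝ` carries the product model `𝓡 3 × 𝓘(ℝ, ℝ)`, its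
      -- tangent vectors are pairs `(v, s)`, and the product metric is `h(v,v) + s²`
      (∀ R η : ℝ, 0 < η →
        ∃ (U : Set (N × ℝ)) (Φ : N × ℝ → M) (Ψ : M → N × ℝ),
          IsOpen U ∧ {y : N | φ y < R} ×ˢ Set.Ioo (-R) R ⊆ U ∧
          ContMDiffOn ((𝓡 3).prod 𝓘(ℝ, ℝ)) (𝓡 4) ∞ Φ U ∧ IsOpen (Φ '' U) ∧
          ContMDiffOn (𝓡 4) ((𝓡 3).prod 𝓘(ℝ, ℝ)) ∞ Ψ (Φ '' U) ∧
          (∀ p ∈ U, Ψ (Φ p) = p) ∧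
          (∀ p ∈ U, ∀ (v : EuclideanSpace ℝ (Fin 3)) (s : ℝ),
            (1 - η) * (h.val p.1 v v + s ^ 2) ≤
              g.val (Φ p) (mfderiv ((𝓡 3).prod 𝓘(ℝ, ℝ)) (𝓡 4) Φ p (v, s))
                (mfderiv ((𝓡 3).prod 𝓘(ℝ, ℝ)) (𝓡 4) Φ p (v, s)) ∧
            g.val (Φ p) (mfderiv ((𝓡 3).prod 𝓘(ℝ, ℝ)) (𝓡 4) Φ p (v, s))
                (mfderiv ((𝓡 3).prod 𝓘(ℝ, ℝ)) (𝓡 4) Φ p (v, s)) ≤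
              (1 + η) * (h.val p.1 v v + s ^ 2)) ∧
          (∀ p ∈ U, |g.scalarCurvature (Φ p) - h.scalarCurvature p.1| ≤ η))

end Literature.Geometry.Riemannian

end
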